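import Summits.MatrixMultiplication.OmegaCensus.DicyclicClassBStable
import Summits.MatrixMultiplication.OmegaCensus.DicyclicParityTools
import Summits.MatrixMultiplication.OmegaCensus.CubeLawParity
import HarnessLib

/-!
# Class B for odd-part quotients, core: even fibres of the even member and the defect-two vertex character sums

ω-census `pub-omega`, family (b3), seat pub-omega-group gen 13.  Framing: lottery ticket; floor = certified bounds/negative
ranges.  VALUE: kernel lemmas for the TPP capacity of dihedral-like groups; NOT progress on ω.

Class B of the dicyclic-law triples (`(s,s),(t,t),(u,u)`, `|A| = 3stu + 2`, `s, t` odd, `u` even): every vertex of the cube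
has slack `2`.  Two tools for the general (odd-part) case, both independent of any `2`-group hypothesis on `A/⟨c₀⟩`:

* `even_fibres_of_periodic_box_odd_odd`, `classB_even_fibres`: gen 12's `periodic_of_periodic_box_odd_odd` /
  `classB_parts_periodic` (two periodic boxes at the vertices `000`, `111` by `two_periodic_of_slack_two`, then the
  transfer with two odd factors) for ANY homomorphism `π : A →+ B` into a `2`-group with `π c₀ = 0`: the conclusion is that
  all `π`-fibre counts of `U₀` and of `U₁` are even (for `π = A → A/⟨c₀⟩` a `2`-group this was periodicity).
* `realChar_near_tiling_two`, `vertex000_sgnSum_two`, `vertex111_sgnSum_two`: the real-character vertex identities of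
  `CubeLawParity.lean` for defect `2`: the three box products `σπξ` at a vertex sum to `0` or `±2`.
Consumed by `DicyclicClassBGeneral.lean`.
-/

namespace Summit.MatrixMultiplication.OmegaCensus

open Literature.Combinatorics.Additive Finset

section Transfer

variable {A : Type} [AddCommGroup A] [Fintype A] [DecidableEq A] {B : Type} [AddCommGroup B] [Fintype B]
  [DecidableEq B]

omit [Fintype A] in
/-- **Even fibres from a periodic box with two odd factors.**  `π : A →+ B`, `2^m · B = 0`, `π c₀ = 0` (`c₀ ≠ 0`,
`2c₀ = 0`); an injective `c₀`-periodic box `X + Y + W` with `|X|`, `|Y|` odd.  Then every `π`-fibre count of `W` is even.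
[folklore] -/
theorem even_fibres_of_periodic_box_odd_odd (π : A →+ B) {c₀ : A} (hπc : π c₀ = 0) (hc₀ : c₀ ≠ 0) (h2c : c₀ + c₀ = 0)
    {m : ℕ} (hB : ∀ b : B, (2 ^ m) • b = 0) {X Y W : Finset A} (hX : Odd X.card) (hY : Odd Y.card)
    (hinj : Set.InjOn (fun p : A × A × A => p.1 + p.2.1 + p.2.2) ↑(X ×ˢ Y ×ˢ W))
    (hper : ((X ×ˢ Y ×ˢ W).image fun p : A × A × A => p.1 + p.2.1 + p.2.2).image (· + c₀) =
      (X ×ˢ Y ×ˢ W).image fun p : A × A × A => p.1 + p.2.1 + p.2.2) :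
    ∀ z : B, 2 ∣ (W.filter fun w => π w = z).card := by
  set H : B → ℕ := fun b => (W.filter fun w => π w = b).card with hH
  set H₂ : B → ℕ := fun z => ∑ y ∈ Y, H (z - π y) with hH₂
  have hev : ∀ t : B, 2 ∣ ∑ x ∈ X, H₂ (t - π x) := by
    intro t
    have := even_card_fibre_of_periodic π hπc hc₀ h2c hper t
    rw [card_fibre_box_eq_sum π hinj] at this
    simpa only [hH₂, hH] using this
  have hev₂ : ∀ z : B, 2 ∣ ∑ y ∈ Y, H (z - π y) := even_of_odd_weight_convolution π hB hX H₂ hev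
  exact even_of_odd_weight_convolution π hB hY H hev₂

end Transfer

section Sign

variable {A : Type*} [AddCommGroup A] [Fintype A] [DecidableEq A] {χ : A → ℤ}

omit [AddCommGroup A] in
/-- Three pairwise disjoint sets of total size `|A| − 2`: for a `±1`-valued function summing to `0` over `A` their
`χ`-sums add up to `0` or `±2` (minus the values at the two missed points). [folklore] -/
theorem realChar_near_tiling_two (hval : ∀ a, χ a = 1 ∨ χ a = -1) (hsum : ∑ a, χ a = 0) {P Q R : Finset A}
    (hPQ : Disjoint P Q) (hPR : Disjoint P R) (hQR : Disjoint Q R)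
    (hcard : P.card + Q.card + R.card + 2 = Fintype.card A) :
    (∑ x ∈ P, χ x) + (∑ x ∈ Q, χ x) + (∑ x ∈ R, χ x) = 0 ∨
      (∑ x ∈ P, χ x) + (∑ x ∈ Q, χ x) + (∑ x ∈ R, χ x) = 2 ∨
      (∑ x ∈ P, χ x) + (∑ x ∈ Q, χ x) + (∑ x ∈ R, χ x) = -2 := by
  set W := P ∪ Q ∪ R with hW
  have cW : W.card = P.card + Q.card + R.card := by
    rw [hW, card_union_of_disjoint (disjoint_union_left.2 ⟨hPR, hQR⟩), card_union_of_disjoint hPQ]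
  have hC : (univ \ W).card = 2 := by rw [card_univ_sdiff, cW]; omega
  obtain ⟨x, y, hxy, hxy'⟩ := card_eq_two.1 hC
  have hsplit : ∑ a, χ a = (∑ a ∈ W, χ a) + ∑ a ∈ univ \ W, χ a := by
    rw [← sum_union disjoint_sdiff, union_sdiff_of_subset (subset_univ W)]
  rw [hsum, hxy', sum_pair hxy, hW, sum_union (disjoint_union_left.2 ⟨hPR, hQR⟩), sum_union hPQ] at hsplit
  rcases hval x with h | h <;> rcases hval y with h' | h' <;> rw [h, h'] at hsplit
  · right; right; linarith
  · left; linarith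
  · left; linarith
  · right; left; linarith

end Sign

section Vertex

variable {A : Type*} [AddCommGroup A] [DecidableEq A] [Fintype A] {G : Type} [Group G] [DecidableEq G]
  {ρ τ : A → G} {c₀ : A} {S T U : Finset G} {χ : A → ℤ}

/-- **Vertex `000`.** If the three boxes `S₁+T₀+U₀`, `S₀+T₁+U₀`, `S₀+T₀+U₁` of a TPP triple have total size
`|A| − 2`, then `σ₁π₀ξ₀ + σ₀π₁ξ₀ + σ₀π₀ξ₁ ∈ {0, ±2}` for the `χ`-sums of the parts. [folklore] -/
theorem vertex000_sgnSum_two (hρρ : ∀ a b, ρ a * ρ b = ρ (a + b)) (hρτ : ∀ a b, ρ a * τ b = τ (b - a))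
    (hτρ : ∀ a b, τ a * ρ b = τ (a + b)) (hττ : ∀ a b, τ a * τ b = ρ (c₀ + b - a))
    (hρ : Function.Injective ρ) (hτ : Function.Injective τ) (hne : ∀ a b, ρ a ≠ τ b)
    (h : TripleProductProperty S T U) (hmul : ∀ a b, χ (a + b) = χ a * χ b) (hval : ∀ a, χ a = 1 ∨ χ a = -1) (hsum : ∑ a, χ a = 0)
    (h000 : (univ.filter fun a : A => τ a ∈ S).card * (univ.filter fun a : A => ρ a ∈ T).card *
        (univ.filter fun a : A => ρ a ∈ U).card +
      (univ.filter fun a : A => ρ a ∈ S).card * (univ.filter fun a : A => τ a ∈ T).card *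
        (univ.filter fun a : A => ρ a ∈ U).card +
      (univ.filter fun a : A => ρ a ∈ S).card * (univ.filter fun a : A => ρ a ∈ T).card *
        (univ.filter fun a : A => τ a ∈ U).card + 2 = Fintype.card A) :
    (∑ a ∈ univ.filter (fun a : A => τ a ∈ S), χ a) * (∑ a ∈ univ.filter (fun a : A => ρ a ∈ T), χ a) * (∑ a ∈ univ.filter (fun a : A => ρ a ∈ U), χ a) + (∑ a ∈ univ.filter (fun a : A => ρ a ∈ S), χ a) * (∑ a ∈ univ.filter (fun a : A => τ a ∈ T), χ a) * (∑ a ∈ univ.filter (fun a : A => ρ a ∈ U), χ a) +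
        (∑ a ∈ univ.filter (fun a : A => ρ a ∈ S), χ a) * (∑ a ∈ univ.filter (fun a : A => ρ a ∈ T), χ a) * (∑ a ∈ univ.filter (fun a : A => τ a ∈ U), χ a) = 0 ∨
      (∑ a ∈ univ.filter (fun a : A => τ a ∈ S), χ a) * (∑ a ∈ univ.filter (fun a : A => ρ a ∈ T), χ a) * (∑ a ∈ univ.filter (fun a : A => ρ a ∈ U), χ a) + (∑ a ∈ univ.filter (fun a : A => ρ a ∈ S), χ a) * (∑ a ∈ univ.filter (fun a : A => τ a ∈ T), χ a) * (∑ a ∈ univ.filter (fun a : A => ρ a ∈ U), χ a) +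
        (∑ a ∈ univ.filter (fun a : A => ρ a ∈ S), χ a) * (∑ a ∈ univ.filter (fun a : A => ρ a ∈ T), χ a) * (∑ a ∈ univ.filter (fun a : A => τ a ∈ U), χ a) = 2 ∨
      (∑ a ∈ univ.filter (fun a : A => τ a ∈ S), χ a) * (∑ a ∈ univ.filter (fun a : A => ρ a ∈ T), χ a) * (∑ a ∈ univ.filter (fun a : A => ρ a ∈ U), χ a) + (∑ a ∈ univ.filter (fun a : A => ρ a ∈ S), χ a) * (∑ a ∈ univ.filter (fun a : A => τ a ∈ T), χ a) * (∑ a ∈ univ.filter (fun a : A => ρ a ∈ U), χ a) +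
        (∑ a ∈ univ.filter (fun a : A => ρ a ∈ S), χ a) * (∑ a ∈ univ.filter (fun a : A => ρ a ∈ T), χ a) * (∑ a ∈ univ.filter (fun a : A => τ a ∈ U), χ a) = -2 := by
  set S₀ : Finset A := univ.filter fun a => ρ a ∈ S with hS₀
  set S₁ : Finset A := univ.filter fun a => τ a ∈ S with hS₁
  set T₀ : Finset A := univ.filter fun a => ρ a ∈ T with hT₀
  set T₁ : Finset A := univ.filter fun a => τ a ∈ T with hT₁
  set U₀ : Finset A := univ.filter fun a => ρ a ∈ U with hU₀
  set U₁ : Finset A := univ.filter fun a => τ a ∈ U with hU₁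
  have mS₀ : ∀ a ∈ S₀, cond false (τ a) (ρ a) ∈ S := fun a ha => by simpa [hS₀] using ha
  have mS₁ : ∀ a ∈ S₁, cond true (τ a) (ρ a) ∈ S := fun a ha => by simpa [hS₁] using ha
  have mT₀ : ∀ a ∈ T₀, cond false (τ a) (ρ a) ∈ T := fun a ha => by simpa [hT₀] using ha
  have mT₁ : ∀ a ∈ T₁, cond true (τ a) (ρ a) ∈ T := fun a ha => by simpa [hT₁] using ha
  have mU₀ : ∀ a ∈ U₀, cond false (τ a) (ρ a) ∈ U := fun a ha => by simpa [hU₀] using ha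
  have mU₁ : ∀ a ∈ U₁, cond true (τ a) (ρ a) ∈ U := fun a ha => by simpa [hU₁] using ha
  have cs := card_sumset' hρρ hττ hρ hτ h
  have inj := sum_injOn' hρρ hττ hρ hτ h
  have d₁ := disjoint_sumset₁' hρρ hρτ hτρ hττ hne h
  have d₂ := disjoint_sumset₂' hρρ hρτ hτρ hττ hne h
  have d₃ := disjoint_sumset₃' hρρ hρτ hτρ hττ hne h
  have key := realChar_near_tiling_two hval hsum (d₁ false mS₁ mT₀ mU₀ mS₀ mT₁) (d₃ false mS₀ mT₀ mU₁ mS₁ mU₀).symm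
    (d₂ false mS₀ mT₁ mU₀ mS₀ mT₀ mU₁)
    (by rw [cs true false false mS₁ mT₀ mU₀, cs false true false mS₀ mT₁ mU₀, cs false false true mS₀ mT₀ mU₁]
        exact h000)
  rw [realChar_sumset hmul (inj true false false mS₁ mT₀ mU₀), realChar_sumset hmul (inj false true false mS₀ mT₁ mU₀),
    realChar_sumset hmul (inj false false true mS₀ mT₀ mU₁)] at key
  exact key

/-- **Vertex `111`.** If the three boxes `S₀+T₁+U₁`, `S₁+T₀+U₁`, `S₁+T₁+U₀` of a TPP triple have total size
`|A| − 2`, then `σ₀π₁ξ₁ + σ₁π₀ξ₁ + σ₁π₁ξ₀ ∈ {0, ±2}`. [folklore] -/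
theorem vertex111_sgnSum_two (hρρ : ∀ a b, ρ a * ρ b = ρ (a + b)) (hρτ : ∀ a b, ρ a * τ b = τ (b - a))
    (hτρ : ∀ a b, τ a * ρ b = τ (a + b)) (hττ : ∀ a b, τ a * τ b = ρ (c₀ + b - a))
    (hρ : Function.Injective ρ) (hτ : Function.Injective τ) (hne : ∀ a b, ρ a ≠ τ b)
    (h : TripleProductProperty S T U) (hmul : ∀ a b, χ (a + b) = χ a * χ b) (hval : ∀ a, χ a = 1 ∨ χ a = -1) (hsum : ∑ a, χ a = 0)
    (h111 : (univ.filter fun a : A => ρ a ∈ S).card * (univ.filter fun a : A => τ a ∈ T).card *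
        (univ.filter fun a : A => τ a ∈ U).card +
      (univ.filter fun a : A => τ a ∈ S).card * (univ.filter fun a : A => ρ a ∈ T).card *
        (univ.filter fun a : A => τ a ∈ U).card +
      (univ.filter fun a : A => τ a ∈ S).card * (univ.filter fun a : A => τ a ∈ T).card *
        (univ.filter fun a : A => ρ a ∈ U).card + 2 = Fintype.card A) :
    (∑ a ∈ univ.filter (fun a : A => ρ a ∈ S), χ a) * (∑ a ∈ univ.filter (fun a : A => τ a ∈ T), χ a) * (∑ a ∈ univ.filter (fun a : A => τ a ∈ U), χ a) + (∑ a ∈ univ.filter (fun a : A => τ a ∈ S), χ a) * (∑ a ∈ univ.filter (fun a : A => ρ a ∈ T), χ a) * (∑ a ∈ univ.filter (fun a : A => τ a ∈ U), χ a) +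
        (∑ a ∈ univ.filter (fun a : A => τ a ∈ S), χ a) * (∑ a ∈ univ.filter (fun a : A => τ a ∈ T), χ a) * (∑ a ∈ univ.filter (fun a : A => ρ a ∈ U), χ a) = 0 ∨
      (∑ a ∈ univ.filter (fun a : A => ρ a ∈ S), χ a) * (∑ a ∈ univ.filter (fun a : A => τ a ∈ T), χ a) * (∑ a ∈ univ.filter (fun a : A => τ a ∈ U), χ a) + (∑ a ∈ univ.filter (fun a : A => τ a ∈ S), χ a) * (∑ a ∈ univ.filter (fun a : A => ρ a ∈ T), χ a) * (∑ a ∈ univ.filter (fun a : A => τ a ∈ U), χ a) +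
        (∑ a ∈ univ.filter (fun a : A => τ a ∈ S), χ a) * (∑ a ∈ univ.filter (fun a : A => τ a ∈ T), χ a) * (∑ a ∈ univ.filter (fun a : A => ρ a ∈ U), χ a) = 2 ∨
      (∑ a ∈ univ.filter (fun a : A => ρ a ∈ S), χ a) * (∑ a ∈ univ.filter (fun a : A => τ a ∈ T), χ a) * (∑ a ∈ univ.filter (fun a : A => τ a ∈ U), χ a) + (∑ a ∈ univ.filter (fun a : A => τ a ∈ S), χ a) * (∑ a ∈ univ.filter (fun a : A => ρ a ∈ T), χ a) * (∑ a ∈ univ.filter (fun a : A => τ a ∈ U), χ a) +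
        (∑ a ∈ univ.filter (fun a : A => τ a ∈ S), χ a) * (∑ a ∈ univ.filter (fun a : A => τ a ∈ T), χ a) * (∑ a ∈ univ.filter (fun a : A => ρ a ∈ U), χ a) = -2 := by
  set S₀ : Finset A := univ.filter fun a => ρ a ∈ S with hS₀
  set S₁ : Finset A := univ.filter fun a => τ a ∈ S with hS₁
  set T₀ : Finset A := univ.filter fun a => ρ a ∈ T with hT₀
  set T₁ : Finset A := univ.filter fun a => τ a ∈ T with hT₁
  set U₀ : Finset A := univ.filter fun a => ρ a ∈ U with hU₀
  set U₁ : Finset A := univ.filter fun a => τ a ∈ U with hU₁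
  have mS₀ : ∀ a ∈ S₀, cond false (τ a) (ρ a) ∈ S := fun a ha => by simpa [hS₀] using ha
  have mS₁ : ∀ a ∈ S₁, cond true (τ a) (ρ a) ∈ S := fun a ha => by simpa [hS₁] using ha
  have mT₀ : ∀ a ∈ T₀, cond false (τ a) (ρ a) ∈ T := fun a ha => by simpa [hT₀] using ha
  have mT₁ : ∀ a ∈ T₁, cond true (τ a) (ρ a) ∈ T := fun a ha => by simpa [hT₁] using ha
  have mU₀ : ∀ a ∈ U₀, cond false (τ a) (ρ a) ∈ U := fun a ha => by simpa [hU₀] using ha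
  have mU₁ : ∀ a ∈ U₁, cond true (τ a) (ρ a) ∈ U := fun a ha => by simpa [hU₁] using ha
  have cs := card_sumset' hρρ hττ hρ hτ h
  have inj := sum_injOn' hρρ hττ hρ hτ h
  have d₁ := disjoint_sumset₁' hρρ hρτ hτρ hττ hne h
  have d₂ := disjoint_sumset₂' hρρ hρτ hτρ hττ hne h
  have d₃ := disjoint_sumset₃' hρρ hρτ hτρ hττ hne h
  -- boxes `P = S₀+T₁+U₁`, `Q = S₁+T₀+U₁`, `R = S₁+T₁+U₀`
  have key := realChar_near_tiling_two hval hsum (d₁ true mS₁ mT₀ mU₁ mS₀ mT₁).symm (d₃ true mS₀ mT₁ mU₁ mS₁ mU₀)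
    (d₂ true mS₁ mT₁ mU₀ mS₁ mT₀ mU₁).symm
    (by rw [cs false true true mS₀ mT₁ mU₁, cs true false true mS₁ mT₀ mU₁, cs true true false mS₁ mT₁ mU₀]
        exact h111)
  rw [realChar_sumset hmul (inj false true true mS₀ mT₁ mU₁), realChar_sumset hmul (inj true false true mS₁ mT₀ mU₁),
    realChar_sumset hmul (inj true true false mS₁ mT₁ mU₀)] at key
  exact key

end Vertex

/-! ## Class B: even fibres of the even member -/

section ClassB

variable {A : Type} [AddCommGroup A] [DecidableEq A] [Fintype A] {G : Type} [Group G] [DecidableEq G]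
  {ρ τ : A → G} {c₀ : A} {B : Type} [AddCommGroup B] [DecidableEq B] [Fintype B]

/-- **The even member of a class-B triple has even fibres over any `2`-group image.**  Dicyclic type, `π : A →+ B` into a
`2`-group with `π c₀ = 0`; a TPP triple with `|S₀| = |S₁| = s`, `|T₀| = |T₁| = t`, `|U₀| = |U₁| = u`, `|A| ≤ 3stu + 2`, `s, t` odd
and `u` even.  Then all `π`-fibre counts of `U₀` and of `U₁` are even (gen 12's `classB_parts_periodic` up to its last step). [folklore] -/
theorem classB_even_fibres
    (hρρ : ∀ a b, ρ a * ρ b = ρ (a + b)) (hρτ : ∀ a b, ρ a * τ b = τ (b - a))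
    (hτρ : ∀ a b, τ a * ρ b = τ (a + b)) (hττ : ∀ a b, τ a * τ b = ρ (c₀ + b - a)) (hc₀ : c₀ ≠ 0)
    (hρ : Function.Injective ρ) (hτ : Function.Injective τ) (hne : ∀ a b, ρ a ≠ τ b)
    (π : A →+ B) (hπc : π c₀ = 0) {m : ℕ} (hB : ∀ b : B, (2 ^ m) • b = 0)
    {S T U : Finset G} (h : TripleProductProperty S T U) {s t u : ℕ}
    (hs₀ : (univ.filter fun a : A => ρ a ∈ S).card = s) (hs₁ : (univ.filter fun a : A => τ a ∈ S).card = s)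
    (ht₀ : (univ.filter fun a : A => ρ a ∈ T).card = t) (ht₁ : (univ.filter fun a : A => τ a ∈ T).card = t)
    (hu₀ : (univ.filter fun a : A => ρ a ∈ U).card = u) (hu₁ : (univ.filter fun a : A => τ a ∈ U).card = u)
    (hs : Odd s) (ht : Odd t) (hu : Even u) (hA : Fintype.card A ≤ 3 * (s * t * u) + 2) :
    (∀ z : B, 2 ∣ ((univ.filter fun a : A => ρ a ∈ U).filter fun a => π a = z).card) ∧
    (∀ z : B, 2 ∣ ((univ.filter fun a : A => τ a ∈ U).filter fun a => π a = z).card) := by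
  set S₀ : Finset A := univ.filter fun a => ρ a ∈ S with hS₀
  set S₁ : Finset A := univ.filter fun a => τ a ∈ S with hS₁
  set T₀ : Finset A := univ.filter fun a => ρ a ∈ T with hT₀
  set T₁ : Finset A := univ.filter fun a => τ a ∈ T with hT₁
  set U₀ : Finset A := univ.filter fun a => ρ a ∈ U with hU₀
  set U₁ : Finset A := univ.filter fun a => τ a ∈ U with hU₁
  have h2c := two_c0_eq_zero hρτ hτρ hττ hτ
  have mS₀ : ∀ a ∈ S₀, cond false (τ a) (ρ a) ∈ S := fun a ha => by simpa [hS₀] using ha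
  have mS₁ : ∀ a ∈ S₁, cond true (τ a) (ρ a) ∈ S := fun a ha => by simpa [hS₁] using ha
  have mT₀ : ∀ a ∈ T₀, cond false (τ a) (ρ a) ∈ T := fun a ha => by simpa [hT₀] using ha
  have mT₁ : ∀ a ∈ T₁, cond true (τ a) (ρ a) ∈ T := fun a ha => by simpa [hT₁] using ha
  have mU₀ : ∀ a ∈ U₀, cond false (τ a) (ρ a) ∈ U := fun a ha => by simpa [hU₀] using ha
  have mU₁ : ∀ a ∈ U₁, cond true (τ a) (ρ a) ∈ U := fun a ha => by simpa [hU₁] using ha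
  have mT₀' : ∀ a ∈ T₀, ρ a ∈ T := fun a ha => (mem_filter.1 ha).2
  have mT₁' : ∀ a ∈ T₁, τ a ∈ T := fun a ha => (mem_filter.1 ha).2
  have mS₀' : ∀ a ∈ S₀, ρ a ∈ S := fun a ha => (mem_filter.1 ha).2
  have mS₁' : ∀ a ∈ S₁, τ a ∈ S := fun a ha => (mem_filter.1 ha).2
  have mU₀' : ∀ a ∈ U₀, ρ a ∈ U := fun a ha => (mem_filter.1 ha).2
  have mU₁' : ∀ a ∈ U₁, τ a ∈ U := fun a ha => (mem_filter.1 ha).2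
  have cs := card_sumset' hρρ hττ hρ hτ h
  have inj := sum_injOn' hρρ hττ hρ hτ h
  have oS₀ : Odd S₀.card := by rw [hs₀]; exact hs
  have oS₁ : Odd S₁.card := by rw [hs₁]; exact hs
  have oT₀ : Odd T₀.card := by rw [ht₀]; exact ht
  have oT₁ : Odd T₁.card := by rw [ht₁]; exact ht
  obtain ⟨u', hu'⟩ := hu
  have ev : 2 ∣ s * t * u := ⟨s * t * u', by rw [hu']; ring⟩
  -- the boxes
  set B100 := (S₁ ×ˢ T₀ ×ˢ U₀).image fun p : A × A × A => p.1 + p.2.1 + p.2.2 with hB100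
  set B010 := (S₀ ×ˢ T₁ ×ˢ U₀).image fun p : A × A × A => p.1 + p.2.1 + p.2.2 with hB010
  set B001 := (S₀ ×ˢ T₀ ×ˢ U₁).image fun p : A × A × A => p.1 + p.2.1 + p.2.2 with hB001
  set B011 := (S₀ ×ˢ T₁ ×ˢ U₁).image fun p : A × A × A => p.1 + p.2.1 + p.2.2 with hB011
  set B101 := (S₁ ×ˢ T₀ ×ˢ U₁).image fun p : A × A × A => p.1 + p.2.1 + p.2.2 with hB101
  set B110 := (S₁ ×ˢ T₁ ×ˢ U₀).image fun p : A × A × A => p.1 + p.2.1 + p.2.2 with hB110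
  have c100 : B100.card = s * t * u := by rw [hB100, cs true false false mS₁ mT₀ mU₀, hs₁, ht₀, hu₀]
  have c010 : B010.card = s * t * u := by rw [hB010, cs false true false mS₀ mT₁ mU₀, hs₀, ht₁, hu₀]
  have c001 : B001.card = s * t * u := by rw [hB001, cs false false true mS₀ mT₀ mU₁, hs₀, ht₀, hu₁]
  have c011 : B011.card = s * t * u := by rw [hB011, cs false true true mS₀ mT₁ mU₁, hs₀, ht₁, hu₁]
  have c101 : B101.card = s * t * u := by rw [hB101, cs true false true mS₁ mT₀ mU₁, hs₁, ht₀, hu₁]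
  have c110 : B110.card = s * t * u := by rw [hB110, cs true true false mS₁ mT₁ mU₀, hs₁, ht₁, hu₀]
  -- disjointness, plain and shifted, at the vertices `000` and `111`
  have d₁ : Disjoint B100 B010 := (disjoint_sumset₁' hρρ hρτ hτρ hττ hne h) false mS₁' mT₀' mU₀ mS₀' mT₁'
  have d₂ : Disjoint B010 B001 := (disjoint_sumset₂' hρρ hρτ hτρ hττ hne h) false mS₀ mT₁' mU₀' mS₀ mT₀' mU₁'
  have d₃ : Disjoint B001 B100 := (disjoint_sumset₃' hρρ hρτ hτρ hττ hne h) false mS₀' mT₀ mU₁' mS₁' mU₀'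
  have sh₁ : Disjoint B100 (B010.image (· + c₀)) :=
    (disjoint_sumset₁_shift' hρρ hρτ hττ hne h) false mS₁' mT₀' mU₀ mS₀' mT₁'
  have sh₂ : Disjoint (B001.image (· + c₀)) B010 :=
    (disjoint_sumset₂_shift' hρρ hρτ hττ hne h) false mS₀ mT₀' mU₁' mS₀ mT₁' mU₀'
  have sh₃ : Disjoint B100 (B001.image (· + c₀)) :=
    (disjoint_sumset₃_shift' hρρ hρτ hτρ hττ hne h) false mS₁' mT₀ mU₀' mS₀' mU₁'
  have d₁' : Disjoint B101 B011 := (disjoint_sumset₁' hρρ hρτ hτρ hττ hne h) true mS₁' mT₀' mU₁ mS₀' mT₁'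
  have d₂' : Disjoint B110 B101 := (disjoint_sumset₂' hρρ hρτ hτρ hττ hne h) true mS₁ mT₁' mU₀' mS₁ mT₀' mU₁'
  have d₃' : Disjoint B011 B110 := (disjoint_sumset₃' hρρ hρτ hτρ hττ hne h) true mS₀' mT₁ mU₁' mS₁' mU₀'
  have sh₁' : Disjoint B101 (B011.image (· + c₀)) :=
    (disjoint_sumset₁_shift' hρρ hρτ hττ hne h) true mS₁' mT₀' mU₁ mS₀' mT₁'
  have sh₂' : Disjoint (B101.image (· + c₀)) B110 :=
    (disjoint_sumset₂_shift' hρρ hρτ hττ hne h) true mS₁ mT₀' mU₁' mS₁ mT₁' mU₀'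
  have sh₃' : Disjoint B110 (B011.image (· + c₀)) :=
    (disjoint_sumset₃_shift' hρρ hρτ hτρ hττ hne h) true mS₁' mT₁ mU₀' mS₀' mU₁'
  -- two periodic boxes at each of the two vertices
  have v000 := two_periodic_of_slack_two hc₀ h2c d₁ d₃.symm d₂ sh₁ sh₃ sh₂.symm
    (by rw [c100]; exact ev) (by rw [c010]; exact ev) (by rw [c001]; exact ev) (by rw [c100, c010, c001]; omega)
  have v111 := two_periodic_of_slack_two hc₀ h2c d₁' d₂'.symm d₃' sh₁'
    (disjoint_image_add_comm h2c sh₂'.symm).symm (disjoint_image_add_comm h2c sh₃').symm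
    (by rw [c101]; exact ev) (by rw [c011]; exact ev) (by rw [c110]; exact ev) (by rw [c101, c011, c110]; omega)
  -- a periodic box on each coset of `U`
  have hU₀ : ∀ z : B, 2 ∣ (U₀.filter fun a => π a = z).card := by
    rcases v000 with ⟨p, -⟩ | ⟨p, -⟩ | ⟨p, -⟩
    · exact even_fibres_of_periodic_box_odd_odd π hπc hc₀ h2c hB oS₁ oT₀ (inj true false false mS₁ mT₀ mU₀) p
    · exact even_fibres_of_periodic_box_odd_odd π hπc hc₀ h2c hB oS₁ oT₀ (inj true false false mS₁ mT₀ mU₀) p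
    · exact even_fibres_of_periodic_box_odd_odd π hπc hc₀ h2c hB oS₀ oT₁ (inj false true false mS₀ mT₁ mU₀) p
  have hU₁ : ∀ z : B, 2 ∣ (U₁.filter fun a => π a = z).card := by
    rcases v111 with ⟨p, -⟩ | ⟨p, -⟩ | ⟨p, -⟩
    · exact even_fibres_of_periodic_box_odd_odd π hπc hc₀ h2c hB oS₁ oT₀ (inj true false true mS₁ mT₀ mU₁) p
    · exact even_fibres_of_periodic_box_odd_odd π hπc hc₀ h2c hB oS₁ oT₀ (inj true false true mS₁ mT₀ mU₁) p
    · exact even_fibres_of_periodic_box_odd_odd π hπc hc₀ h2c hB oS₀ oT₁ (inj false true true mS₀ mT₁ mU₁) p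
  exact ⟨hU₀, hU₁⟩

end ClassB

end Summit.MatrixMultiplication.OmegaCensus
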